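import Summits.QuantumFields.BalabanUV.T4Continuum.Support.NE3BlockPoincareCore
import HarnessLib

/-!
# T⁴ programme, node NE3 — BLOCK-POINCARÉ ON THE k-FOLD FLAT TANGENT SPACE (row E-MLw-w3), THE END (matrix directions):
# `Σ nhsNormSq Y ≤ (5 + 2d·N²)·L^{2k}·Σ nhsNormSq ∂Y` and `dirSq Y ≤ n·(5 + 2d·N²)·L^{2k}·Σ‖∂Y‖²` for periodic `Y` with
# `TangentIter L (k−1) 1 Y` — k-FREE, N-dependent — and the N-free twins (constant 5) on the kernel of the STRAIGHT k-block average

NE3 formalisation swarm `b2b-balaban-t4-ne3-formalise-*`, LEAF PROVER 04 (gen 4), row **E-MLw-w3** of `t4/formal/NE3/LEAVES.md`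
(typer v1.44∕v1.45; owner skeleton `t4/skeletons/NE3-t4-ne3-p1.md` v1.9 §4b, sub-leaf (w3) of the socket E-ML_w
`NE3EnergyWeightedShapes.WeightedTangentCoercive`), file (C2b) = the END of the SHAPE note `t4/formal/NE3/Statements/E-MLw-w3-SHAPE-v1.md`;
on (C2a) `NE3BlockPoincareCore` (the complex-valued core and its two instances), taken ENTRYWISE (`MatrixNorms.card_mul_nhsNormSq`,
`opNorm_sq_le_card_mul_nhsNormSq`, `nhsNormSq_le_opNorm_sq`; the k-fold contour average commutes with entries,
`NE3TangentFlatStructure.iterate_Tcoarse_entry_eq_zero`).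

CONTENT (all [folklore]; 0 sorry; 0 def):
* entry bookkeeping `sum_entries_eq_card_mul_nhs`, `sum_entries_grad_eq_card_mul_nhs`, `dirSq_le_card_mul_sum_nhs`, `sum_nhs_grad_le`,
  `iterate_Qcoarse_entry_eq_zero`;
* **`sum_nhsNormSq_le_of_tangentIter_flat`**: `IsPeriodicDir Y (N·L^{j+1}) → TangentIter L j flat Y → Σ_{x∈periodBox(N·L^{j+1})} Σ_κ
  nhsNormSq (Y x κ) ≤ (5 + 2d·N²)·(L^{j+1})²·Σ_x Σ_κ Σ_μ nhsNormSq (Y(x+e_μ) κ − Y x κ)` (Hilbert–Schmidt currency, NO factor n — the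
  hypothesis `hP` of the (ML_w) flat assembly `NE3FlatWeightedCoercive` (leaf-02-g4) with `C_P = 5 + 2d·N²`);
* **`dirSq_le_of_tangentIter_flat`**: the same in the tree's operator-norm `dirSq` (one factor `card n`);
* the N-free twins **`sum_nhsNormSq_le_of_iterate_Qcoarse_eq_zero`** ∕ **`dirSq_le_of_iterate_Qcoarse_eq_zero`** (constant 5) on
  `(Qcoarse L)^[k] Y = 0` (the frames-removed ∕ double-bar tangent space, `BlockAveragePushDirSplit.dbarLin_flat`).

HONEST FRAMING.  Kinematics of the LINEARISED average at the FLAT configuration; k-free, L-free, N-DEPENDENT on the single-bar tangent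
space (SHAPE note §1: N-free is not claimed there and looks false at d = 4; it holds on `ker (Qcoarse L)^[k]`); nothing about
Bałaban's minimisers, (ML_w), T-E_w or NE3 is asserted; NE3 NOT proved; spine 0∕9; finite T⁴ rung (B)+1 — NOT infinite volume, NOT
mass gap, NOT BetaPertH, NOT Clay.  ABSOLUTE RULE kept (nothing printed is a hypothesis).  PLACEMENT: `Summits/QuantumFields/BalabanUV/`.
-/

set_option autoImplicit false

open scoped BigOperators Matrix.Norms.L2Operator
open Finset

namespace Summit.QuantumFields.BalabanUV.T4Continuum.NE3BlockPoincareTangent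

open Literature.MathematicalPhysics.QuantumFieldTheory.Balaban1983to89
open B7Prop1Explicit
open T4AveragingDeficitWall (dirSq)
open T4AveragingDeficitWallBoundary (periodBox mem_periodBox card_periodBox sum_periodBox_shift)
open AveragingDeficitPeriodicCounting (IsPeriodicDir)
open AveragingDeficitMultiLevelPrep (TangentIter)
open BlockAveragePushDirSplit (flat)
open SmoothRefineNeutral (Tcoarse)
open NE3TangentNoGoWords (dPot)
open NE3TangentFlatStructure (Qcoarse framePot iterate_Tcoarse_eq_zero_iff framePot_add_period
  iterate_Tcoarse_eq_zero_of_tangentIter iterate_Tcoarse_entry_eq_zero)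
open NE3BlockLineAverage (iterate_Qcoarse_apply sum_periodBox_blocks norm_lineMean_sub_blockMean_sq_le
  norm_lineMean_sub_shift_sq_le)
open NE3CoarseTorusExact (sum_norm_sub_blockMean_sq_le sum_sq_dPot_le_of_periodic)
open MatrixNorms (nhsNormSq card_mul_nhsNormSq opNorm_sq_le_card_mul_nhsNormSq nhsNormSq_le_opNorm_sq)
open NE3BlockPoincareCore (sum_rotate3' sum_rotate4' sum_norm_sq_le_of_iterate_Tcoarse_eq_zero sum_norm_sq_le_of_iterate_Qcoarse_eq_zero)

noncomputable section

variable {d : ℕ}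

/-! ## §4 Matrices: the row's deliverable in the socket's currencies (normalised Hilbert–Schmidt and operator norm) -/

section Matrices

variable {n : Type*} [Fintype n] [DecidableEq n] [Nonempty n]

omit [DecidableEq n] in
/-- Entry sums are `card n ×` the normalised Hilbert–Schmidt squares: `Σ_{pq} Σ_x Σ_κ ‖Y x κ p q‖² = n·Σ_x Σ_κ nhsNormSq (Y x κ)`.
[folklore] -/
theorem sum_entries_eq_card_mul_nhs (Y : Site d → Fin d → Matrix n n ℂ) (F : Finset (Site d)) :
    ∑ pq : n × n, ∑ x ∈ F, ∑ κ : Fin d, ‖Y x κ pq.1 pq.2‖ ^ 2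
      = Fintype.card n * ∑ x ∈ F, ∑ κ : Fin d, nhsNormSq (Y x κ) := by
  rw [sum_rotate3' (Finset.univ : Finset (n × n)) F Finset.univ (fun pq x κ => ‖Y x κ pq.1 pq.2‖ ^ 2), Finset.mul_sum]
  refine Finset.sum_congr rfl fun x _ => ?_
  rw [Finset.mul_sum]
  refine Finset.sum_congr rfl fun κ _ => ?_
  rw [card_mul_nhsNormSq, Fintype.sum_prod_type]

omit [DecidableEq n] in
/-- The same for the gradients. [folklore] -/
theorem sum_entries_grad_eq_card_mul_nhs (Y : Site d → Fin d → Matrix n n ℂ) (F : Finset (Site d)) :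
    ∑ pq : n × n, ∑ x ∈ F, ∑ κ : Fin d, ∑ μ : Fin d, ‖Y (x + e μ) κ pq.1 pq.2 - Y x κ pq.1 pq.2‖ ^ 2
      = Fintype.card n * ∑ x ∈ F, ∑ κ : Fin d, ∑ μ : Fin d, nhsNormSq (Y (x + e μ) κ - Y x κ) := by
  rw [sum_rotate4' (Finset.univ : Finset (n × n)) F Finset.univ Finset.univ
    (fun pq x κ μ => ‖Y (x + e μ) κ pq.1 pq.2 - Y x κ pq.1 pq.2‖ ^ 2), Finset.mul_sum]
  refine Finset.sum_congr rfl fun x _ => ?_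
  rw [Finset.mul_sum]
  refine Finset.sum_congr rfl fun κ _ => ?_
  rw [Finset.mul_sum]
  refine Finset.sum_congr rfl fun μ _ => ?_
  rw [card_mul_nhsNormSq, Fintype.sum_prod_type]
  exact Finset.sum_congr rfl fun p _ => Finset.sum_congr rfl fun q _ => by rw [Matrix.sub_apply]

omit [Nonempty n] in
/-- From the normalised Hilbert–Schmidt currency to the operator norm: `dirSq ≤ n·Σ nhsNormSq`, `Σ nhsNormSq ∂Y ≤ Σ ‖∂Y‖²`. [folklore] -/
theorem dirSq_le_card_mul_sum_nhs (Y : Site d → Fin d → Matrix n n ℂ) (F : Finset (Site d)) :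
    dirSq Y F ≤ Fintype.card n * ∑ x ∈ F, ∑ κ : Fin d, nhsNormSq (Y x κ) := by
  unfold dirSq
  rw [Finset.mul_sum]
  refine Finset.sum_le_sum fun x _ => ?_
  rw [Finset.mul_sum]
  exact Finset.sum_le_sum fun κ _ => opNorm_sq_le_card_mul_nhsNormSq (Y x κ)

omit [Nonempty n] in
/-- (gradients: `nhsNormSq ≤ ‖·‖²` termwise) [folklore] -/
theorem sum_nhs_grad_le (Y : Site d → Fin d → Matrix n n ℂ) (F : Finset (Site d)) :
    ∑ x ∈ F, ∑ κ : Fin d, ∑ μ : Fin d, nhsNormSq (Y (x + e μ) κ - Y x κ)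
      ≤ ∑ x ∈ F, ∑ κ : Fin d, ∑ μ : Fin d, ‖Y (x + e μ) κ - Y x κ‖ ^ 2 :=
  Finset.sum_le_sum fun _ _ => Finset.sum_le_sum fun _ _ => Finset.sum_le_sum fun _ _ => nhsNormSq_le_opNorm_sq _

/-- **THE ROW'S DELIVERABLE, HILBERT–SCHMIDT CURRENCY — BLOCK-POINCARÉ ON THE k-FOLD FLAT TANGENT SPACE `ker d(avgIter k)(1)`**:
for `L ≥ 1`, `N ≥ 1`, an `(N·L^{j+1})`-periodic matrix direction `Y` with `TangentIter L j flat Y`,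
`Σ_{x∈periodBox(N·L^{j+1})} Σ_κ nhsNormSq (Y x κ) ≤ (5 + 2d·N²)·(L^{j+1})²·Σ_x Σ_κ Σ_μ nhsNormSq (Y(x+e_μ) κ − Y x κ)` — k-FREE,
L-free, NO factor `n`; the `N²` is the torus factor of the single-bar tangent space (SHAPE note §1).  This is the hypothesis `hP` of the
(ML_w) flat assembly (leaf-02-g4's offer l.13669, `C_P = 5 + 2d·N²`). [folklore] -/
theorem sum_nhsNormSq_le_of_tangentIter_flat {L : ℕ} (hL : 1 ≤ L) {N : ℕ} (hN : 1 ≤ N) {j : ℕ}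
    {Y : Site d → Fin d → Matrix n n ℂ} (hYper : IsPeriodicDir Y ((N * L ^ (j + 1) : ℕ) : ℤ))
    (hY : TangentIter L j (flat (d := d) (n := n)) Y) :
    ∑ x ∈ periodBox (d := d) (N * L ^ (j + 1)), ∑ κ : Fin d, nhsNormSq (Y x κ)
      ≤ (5 + 2 * d * (N : ℝ) ^ 2) * ((L : ℝ) ^ (j + 1)) ^ 2
          * ∑ x ∈ periodBox (d := d) (N * L ^ (j + 1)), ∑ κ : Fin d, ∑ μ : Fin d, nhsNormSq (Y (x + e μ) κ - Y x κ) := by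
  have hT : (Tcoarse L)^[j + 1] Y = 0 := iterate_Tcoarse_eq_zero_of_tangentIter hL j Y hY
  rw [show N * L ^ (j + 1) = L ^ (j + 1) * N from Nat.mul_comm _ _]
  set F := periodBox (d := d) (L ^ (j + 1) * N) with hF
  have hent : ∀ pq : n × n, ∑ x ∈ F, ∑ κ : Fin d, ‖Y x κ pq.1 pq.2‖ ^ 2
      ≤ (5 + 2 * d * (N : ℝ) ^ 2) * ((L : ℝ) ^ (j + 1)) ^ 2
          * ∑ x ∈ F, ∑ κ : Fin d, ∑ μ : Fin d, ‖Y (x + e μ) κ pq.1 pq.2 - Y x κ pq.1 pq.2‖ ^ 2 := by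
    intro pq
    have hper : ∀ (x : Site d) (τ μ : Fin d),
        (fun y ν => Y y ν pq.1 pq.2) (x + ((L ^ (j + 1) * N : ℕ) : ℤ) • e τ) μ = (fun y ν => Y y ν pq.1 pq.2) x μ := by
      intro x τ μ
      simp only
      rw [show (L ^ (j + 1) * N : ℕ) = N * L ^ (j + 1) from Nat.mul_comm _ _, hYper x τ μ]
    exact sum_norm_sq_le_of_iterate_Tcoarse_eq_zero hL hN (j + 1) (fun y ν => Y y ν pq.1 pq.2) hper
      (iterate_Tcoarse_entry_eq_zero L hT pq.1 pq.2)
  have hsum := Finset.sum_le_sum fun pq (_ : pq ∈ (Finset.univ : Finset (n × n))) => hent pq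
  rw [← Finset.mul_sum, sum_entries_eq_card_mul_nhs, sum_entries_grad_eq_card_mul_nhs] at hsum
  have hn : (0 : ℝ) < Fintype.card n := by exact_mod_cast Fintype.card_pos
  rw [mul_left_comm] at hsum
  exact le_of_mul_le_mul_left hsum hn

/-- **THE ROW'S DELIVERABLE, OPERATOR-NORM CURRENCY** (the tree's `dirSq`): for `L ≥ 1`, `N ≥ 1`, an `(N·L^{j+1})`-periodic
direction `Y` with `TangentIter L j flat Y`,
`dirSq Y (periodBox (N·L^{j+1})) ≤ n·(5 + 2d·N²)·(L^{j+1})²·Σ_{x∈periodBox(N·L^{j+1})} Σ_κ Σ_μ ‖Y(x+e_μ) κ − Y x κ‖²`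
(one factor `n` = the operator-norm ∕ Hilbert–Schmidt exchange rate). [folklore] -/
theorem dirSq_le_of_tangentIter_flat {L : ℕ} (hL : 1 ≤ L) {N : ℕ} (hN : 1 ≤ N) {j : ℕ}
    {Y : Site d → Fin d → Matrix n n ℂ} (hYper : IsPeriodicDir Y ((N * L ^ (j + 1) : ℕ) : ℤ))
    (hY : TangentIter L j (flat (d := d) (n := n)) Y) :
    dirSq Y (periodBox (d := d) (N * L ^ (j + 1)))
      ≤ Fintype.card n * (5 + 2 * d * (N : ℝ) ^ 2) * ((L : ℝ) ^ (j + 1)) ^ 2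
          * ∑ x ∈ periodBox (d := d) (N * L ^ (j + 1)), ∑ κ : Fin d, ∑ μ : Fin d, ‖Y (x + e μ) κ - Y x κ‖ ^ 2 := by
  have h := sum_nhsNormSq_le_of_tangentIter_flat hL hN hYper hY
  have hn : (0 : ℝ) ≤ Fintype.card n := Nat.cast_nonneg _
  calc dirSq Y (periodBox (d := d) (N * L ^ (j + 1)))
      ≤ Fintype.card n * ∑ x ∈ periodBox (d := d) (N * L ^ (j + 1)), ∑ κ : Fin d, nhsNormSq (Y x κ) :=
        dirSq_le_card_mul_sum_nhs Y _
    _ ≤ Fintype.card n * ((5 + 2 * d * (N : ℝ) ^ 2) * ((L : ℝ) ^ (j + 1)) ^ 2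
          * ∑ x ∈ periodBox (d := d) (N * L ^ (j + 1)), ∑ κ : Fin d, ∑ μ : Fin d, nhsNormSq (Y (x + e μ) κ - Y x κ)) :=
        mul_le_mul_of_nonneg_left h hn
    _ ≤ Fintype.card n * ((5 + 2 * d * (N : ℝ) ^ 2) * ((L : ℝ) ^ (j + 1)) ^ 2
          * ∑ x ∈ periodBox (d := d) (N * L ^ (j + 1)), ∑ κ : Fin d, ∑ μ : Fin d, ‖Y (x + e μ) κ - Y x κ‖ ^ 2) :=
        mul_le_mul_of_nonneg_left (mul_le_mul_of_nonneg_left (sum_nhs_grad_le Y _) (by positivity)) hn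
    _ = _ := by ring

omit [Nonempty n] in
/-- The straight k-block average commutes with taking an entry (through the tiling). [folklore] -/
theorem iterate_Qcoarse_entry_eq_zero {L : ℕ} (hL : 1 ≤ L) {k : ℕ} {Y : Site d → Fin d → Matrix n n ℂ}
    (hQ : (Qcoarse L)^[k] Y = 0) (pq : n × n) : (Qcoarse L)^[k] (fun y ν => Y y ν pq.1 pq.2) = 0 := by
  funext z κ
  have h1 := iterate_Qcoarse_apply hL k (fun y ν => Y y ν pq.1 pq.2) z κ
  have h2 := iterate_Qcoarse_apply hL k Y z κ
  have h0 : (Qcoarse L)^[k] Y z κ = 0 := by rw [hQ]; rfl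
  rw [h0] at h2
  have h3 := congrArg (fun A : Matrix n n ℂ => A pq.1 pq.2) h2
  simp only [Matrix.zero_apply, Matrix.smul_apply, Matrix.sum_apply] at h3
  rw [h1]
  simp only [Pi.zero_apply]
  exact h3.symm

/-- **N-FREE ON THE KERNEL OF THE STRAIGHT (DOUBLE-BAR) k-BLOCK AVERAGE, Hilbert–Schmidt currency**: for `L ≥ 1`, `N ≥ 1`, an
`(N·L^k)`-periodic `Y` with `(Qcoarse L)^[k] Y = 0`,
`Σ_x Σ_κ nhsNormSq (Y x κ) ≤ 5·(L^k)²·Σ_x Σ_κ Σ_μ nhsNormSq (Y(x+e_μ) κ − Y x κ)` over `periodBox (N·L^k)`. [folklore] -/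
theorem sum_nhsNormSq_le_of_iterate_Qcoarse_eq_zero {L : ℕ} (hL : 1 ≤ L) {N : ℕ} (hN : 1 ≤ N) {k : ℕ}
    {Y : Site d → Fin d → Matrix n n ℂ} (hYper : IsPeriodicDir Y ((N * L ^ k : ℕ) : ℤ))
    (hQ : (Qcoarse L)^[k] Y = 0) :
    ∑ x ∈ periodBox (d := d) (N * L ^ k), ∑ κ : Fin d, nhsNormSq (Y x κ)
      ≤ 5 * ((L : ℝ) ^ k) ^ 2
          * ∑ x ∈ periodBox (d := d) (N * L ^ k), ∑ κ : Fin d, ∑ μ : Fin d, nhsNormSq (Y (x + e μ) κ - Y x κ) := by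
  rw [show N * L ^ k = L ^ k * N from Nat.mul_comm _ _]
  set F := periodBox (d := d) (L ^ k * N) with hF
  have hent : ∀ pq : n × n, ∑ x ∈ F, ∑ κ : Fin d, ‖Y x κ pq.1 pq.2‖ ^ 2
      ≤ 5 * ((L : ℝ) ^ k) ^ 2 * ∑ x ∈ F, ∑ κ : Fin d, ∑ μ : Fin d, ‖Y (x + e μ) κ pq.1 pq.2 - Y x κ pq.1 pq.2‖ ^ 2 := by
    intro pq
    have hper : ∀ (x : Site d) (τ μ : Fin d),
        (fun y ν => Y y ν pq.1 pq.2) (x + ((L ^ k * N : ℕ) : ℤ) • e τ) μ = (fun y ν => Y y ν pq.1 pq.2) x μ := by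
      intro x τ μ
      simp only
      rw [show (L ^ k * N : ℕ) = N * L ^ k from Nat.mul_comm _ _, hYper x τ μ]
    exact sum_norm_sq_le_of_iterate_Qcoarse_eq_zero hL hN k (fun y ν => Y y ν pq.1 pq.2) hper
      (iterate_Qcoarse_entry_eq_zero hL hQ pq)
  have hsum := Finset.sum_le_sum fun pq (_ : pq ∈ (Finset.univ : Finset (n × n))) => hent pq
  rw [← Finset.mul_sum, sum_entries_eq_card_mul_nhs, sum_entries_grad_eq_card_mul_nhs] at hsum
  have hn : (0 : ℝ) < Fintype.card n := by exact_mod_cast Fintype.card_pos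
  rw [mul_left_comm] at hsum
  exact le_of_mul_le_mul_left hsum hn

/-- **N-FREE, OPERATOR-NORM CURRENCY**: for `L ≥ 1`, `N ≥ 1`, an `(N·L^k)`-periodic `Y` with `(Qcoarse L)^[k] Y = 0`,
`dirSq Y (periodBox (N·L^k)) ≤ 5n·(L^k)²·Σ_x Σ_κ Σ_μ ‖Y(x+e_μ) κ − Y x κ‖²`. [folklore] -/
theorem dirSq_le_of_iterate_Qcoarse_eq_zero {L : ℕ} (hL : 1 ≤ L) {N : ℕ} (hN : 1 ≤ N) {k : ℕ}
    {Y : Site d → Fin d → Matrix n n ℂ} (hYper : IsPeriodicDir Y ((N * L ^ k : ℕ) : ℤ))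
    (hQ : (Qcoarse L)^[k] Y = 0) :
    dirSq Y (periodBox (d := d) (N * L ^ k))
      ≤ Fintype.card n * 5 * ((L : ℝ) ^ k) ^ 2
          * ∑ x ∈ periodBox (d := d) (N * L ^ k), ∑ κ : Fin d, ∑ μ : Fin d, ‖Y (x + e μ) κ - Y x κ‖ ^ 2 := by
  have h := sum_nhsNormSq_le_of_iterate_Qcoarse_eq_zero hL hN hYper hQ
  have hn : (0 : ℝ) ≤ Fintype.card n := Nat.cast_nonneg _
  calc dirSq Y (periodBox (d := d) (N * L ^ k))
      ≤ Fintype.card n * ∑ x ∈ periodBox (d := d) (N * L ^ k), ∑ κ : Fin d, nhsNormSq (Y x κ) :=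
        dirSq_le_card_mul_sum_nhs Y _
    _ ≤ Fintype.card n * (5 * ((L : ℝ) ^ k) ^ 2
          * ∑ x ∈ periodBox (d := d) (N * L ^ k), ∑ κ : Fin d, ∑ μ : Fin d, nhsNormSq (Y (x + e μ) κ - Y x κ)) :=
        mul_le_mul_of_nonneg_left h hn
    _ ≤ Fintype.card n * (5 * ((L : ℝ) ^ k) ^ 2
          * ∑ x ∈ periodBox (d := d) (N * L ^ k), ∑ κ : Fin d, ∑ μ : Fin d, ‖Y (x + e μ) κ - Y x κ‖ ^ 2) :=
        mul_le_mul_of_nonneg_left (mul_le_mul_of_nonneg_left (sum_nhs_grad_le Y _) (by positivity)) hn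
    _ = _ := by ring

end Matrices

end

end Summit.QuantumFields.BalabanUV.T4Continuum.NE3BlockPoincareTangent
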